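import Summits.BirchSwinnertonDyer.BirchSwinnertonDyer.Theorems.UniversalToricDescentLayerKummerProduct
import Literature.NumberTheory.IwasawaTheory.Greenberg2006.LocalEulerPoincareCorank
import Summits.BirchSwinnertonDyer.Rank1Residual.GaloisImage.PropagatedConditionCount
import HarnessLib

/-!
# The local factors AT `p` of the layer Poitou–Tate count: `∏_{w ∣ 𝔭} #(𝓞_w/p^k) = p^{k·[L:K]}` at a degree-one place `𝔭 ∣ p`
# (the fundamental identity in completed form), and `∏_{w ∣ 𝔭} #𝓛_w(E/K_m, p^k) = p^{k·p^m}` at the layer `K_m` under (H0)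
# (local conversions for the port stub `stub_residualLinkMult`, line `beta-road` v5 on crux `TwinAlgMuZeroAtThree`, stmt-BirchSwinnertonDyer-24737)

Width prover `bsd-wall-utd-p1-w2` g9 under lead `bsd-wall-utd-p1` g23 (`--supports stmt-BirchSwinnertonDyer-24737`, helper).
THEOREMS ONLY (no definition, no named fact, no `sorry`). BSD is not proved by any of this.

On the line: the layer count `…RelaxedStrictMixedCount.natCard_mixed_mul_strictIndex_mul_strictIndex_le` (p739978) at `L = K_m` carries the
factor `∏_{w ∈ P} #𝓛_w` over the places `P` of `K_m` above the degree-one prime `𝔭 ∋ 3` (`e(𝔭|3) = f(𝔭|3) = 1`); the lead's reduction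
`…ResidualLinkOfLayerCount.residual_finite_of_twoSidedLayerCount` (g23) needs it to be `p^{p^m + O(1)}` EXACTLY (an inert `𝔭` would give
`p^{2p^m}` and break the budget). This file proves `= p^{k·p^m}` on the nose:

* §3 **`prod_natCard_adicCompletionIntegers_quotient_eq_pow_finrank`** — for ANY finite extension `L/K` of number fields and a place
  `𝔭 ∣ p` of `K` with `e(𝔭|p) f(𝔭|p) = 1`: `∏_{w ∣ 𝔭} #(𝓞_w / p) = p^{[L:K]}` (the fundamental identity `Σ_{w∣𝔭} e(w|𝔭) f(w|𝔭) = [L:K]`,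
  Mathlib `Ideal.sum_ramification_inertia`, with `#(𝓞_w/p) = p^{e(w|p) f(w|p)}` — tree
  `Greenberg2006.…natCard_adicCompletionIntegers_quotient_natCast_of_mem` — and the towers `e(w|p) = e(𝔭|p) e(w|𝔭)`, `f(w|p) = f(𝔭|p) f(w|𝔭)`,
  Mathlib `Ideal.ramificationIdx_tower`/`Ideal.inertiaDeg_tower`); `prod_natCard_adicCompletionIntegers_quotient_pow_eq_pow_finrank` — the same for
  `p^k`: `= p^{k·[L:K]}` (`natCard_quotient_span_singleton_mul`: `#(R/(ab)) = #(R/(a))·#(R/(b))`).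
* §3b `ramificationIdx_mul_inertiaDeg_int_eq_one` — the crux's spelling `e(𝔭|𝓞 ℚ) = f(𝔭|𝓞 ℚ) = 1` gives `e(𝔭|ℤ) f(𝔭|ℤ) = 1` (`ℤ → 𝓞 ℚ` onto; tower).
* §4 at the layer `L = K_m` of a `ℤ_p`-extension `κ`: **`prod_natCard_kummerSelmerStructure_inr_layer_eq_pow`** — under (H0)
  «`E[p^k]^{D_𝔭 ⊓ Gal(K̄/K_∞)} = 0`»: `∏_{w ∣ 𝔭} #𝓛_w(E/K_m, p^k) = p^{k·p^m}` (`#𝓛_w = #E(K_{m,w})[p^k] · #(𝓞_w/p^k)`, Milne I 3.3; the torsion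
  factor is `#E[p^k]^{D_𝔭 ⊓ Γ_m} = 1` by the local torsion dictionary `…LayerLocalTorsionDictionary.natCard_ker_nsmul_adicCompletion_layer_eq`;
  `[K_m : K] = p^m`, `ZpExtension.finrank_layer_holds`); `…_of_prime` — the same with (H0) for `E[p]` only
  (`forall_geomTorsion_pow_eq_zero_of_prime`), the shape of the lead's hypothesis `h0`.
With the companion `…LayerLocalFactors` (tame part `≤ p^{2kB}`): `∏_{w∈P} #𝓛_w · ∏_{w∈T} #𝓛_w ≤ p^{k p^m + 2kB}` at every layer, i.e. the
lead's `p^{p^m + c}` with `c = 2B` at `k = 1`.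

References: [NeukirchANT1999] Ch. I §8 Prop. (8.2) (fundamental identity), Ch. II §8 (8.5); [MilneADT2006] I Lemma 3.3;
[Washington1997] §13.1; [GreenbergVatsal2000] §2 Prop. (2.1) (local terms at `p`); [Greenberg2006] §4 A Prop. 4.2.
-/


set_option linter.dupNamespace false
set_option autoImplicit false

noncomputable section
open scoped Classical
open Field NumberField IsDedekindDomain Function WeierstrassCurve
open Literature.NumberTheory.EllipticCurves Literature.NumberTheory.EllipticCurves.GreenbergSelmer
open Literature.NumberTheory.GaloisRepresentations

namespace Summit.BirchSwinnertonDyer.BirchSwinnertonDyer.Theorems.UniversalToricDescentLayerLocalFactorsAtP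

open Summit.BirchSwinnertonDyer.Rank1Residual.Additive Summit.BirchSwinnertonDyer.Rank1Residual.Additive.ZpTower
  Summit.BirchSwinnertonDyer.Rank1Residual.X11b.AcSelmer
  Summit.BirchSwinnertonDyer.BirchSwinnertonDyer.Theorems.UniversalToricDescentLayerLocalTorsionDictionary
  Summit.BirchSwinnertonDyer.BirchSwinnertonDyer.Theorems.UniversalToricDescentLayerKummerProduct

/-! ## §3 Places over a degree-one `𝔭 ∣ p`: the fundamental identity in completed form -/

section DegreeOne

variable {K : Type} [Field K] [NumberField K] {L : Type} [Field L] [NumberField L] [Algebra K L]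
  (p : ℕ) [Fact p.Prime]

/-- **`∏_{w ∣ 𝔭} #(𝓞_w / p) = p^{[L:K]}` at a degree-one place `𝔭 ∣ p`** (`e(𝔭|p) f(𝔭|p) = 1`), for ANY finite extension `L/K` of
number fields and any finset `P` of places of `L` with `w ∈ P ↔ w ∣ 𝔭`: `#(𝓞_w/p) = p^{e(w|p) f(w|p)}` (tree
`Greenberg2006.natCard_adicCompletionIntegers_quotient_natCast_of_mem`), `e(w|p) = e(𝔭|p) e(w|𝔭)` and `f(w|p) = f(𝔭|p) f(w|𝔭)` (Mathlib
`Ideal.ramificationIdx_tower`, `Ideal.inertiaDeg_tower`), and the fundamental identity `Σ_{w ∣ 𝔭} e(w|𝔭) f(w|𝔭) = [L:K]` (Mathlib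
`Ideal.sum_ramification_inertia`). [cite: NeukirchANT1999, Ch. I §8 Prop. (8.2) and Ch. II §8 (8.5)] -/
theorem prod_natCard_adicCompletionIntegers_quotient_eq_pow_finrank (𝔭 : HeightOneSpectrum (𝓞 K))
    (hp𝔭 : ((p : ℕ) : 𝓞 K) ∈ 𝔭.asIdeal) (hef : 𝔭.asIdeal.ramificationIdx ℤ * 𝔭.asIdeal.inertiaDeg ℤ = 1)
    (P : Finset (HeightOneSpectrum (𝓞 L))) (hP : ∀ w, w ∈ P ↔ w.under (𝓞 K) = 𝔭) :
    ∏ w ∈ P, Nat.card (w.adicCompletionIntegers L ⧸ Ideal.span {(p : w.adicCompletionIntegers L)}) =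
      p ^ Module.finrank K L := by
  haveI : Module.Finite (𝓞 K) (𝓞 L) := IsIntegralClosure.finite (𝓞 K) K L (𝓞 L)
  haveI h𝔭max : 𝔭.asIdeal.IsMaximal := 𝔭.isMaximal
  have h𝔭0 : 𝔭.asIdeal ≠ ⊥ := 𝔭.ne_bot
  -- the places of `P` lie over `𝔭`, hence over `p`
  have hlies : ∀ w ∈ P, w.asIdeal.LiesOver 𝔭.asIdeal := fun w hw ↦
    ⟨(congrArg HeightOneSpectrum.asIdeal ((hP w).mp hw)).symm⟩
  have hpw : ∀ w ∈ P, ((p : ℕ) : 𝓞 L) ∈ w.asIdeal := fun w hw ↦ by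
    have h : algebraMap (𝓞 K) (𝓞 L) ((p : ℕ) : 𝓞 K) ∈ w.asIdeal := by
      rw [← Ideal.mem_comap]
      have hu : (w.under (𝓞 K)).asIdeal = Ideal.comap (algebraMap (𝓞 K) (𝓞 L)) w.asIdeal := rfl
      rw [← hu, (hP w).mp hw]
      exact hp𝔭
    rwa [map_natCast] at h
  -- each factor is `p^{e(w|ℤ) f(w|ℤ)} = p^{e(w|𝓞K) f(w|𝓞K)}`
  have hfac : ∀ w ∈ P, Nat.card (w.adicCompletionIntegers L ⧸ Ideal.span {(p : w.adicCompletionIntegers L)}) =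
      p ^ (w.asIdeal.ramificationIdx (𝓞 K) * w.asIdeal.inertiaDeg (𝓞 K)) := by
    intro w hw
    haveI := hlies w hw
    rw [Literature.NumberTheory.IwasawaTheory.Greenberg2006.natCard_adicCompletionIntegers_quotient_natCast_of_mem L w p
      (hpw w hw), Ideal.ramificationIdx_tower (R := ℤ) 𝔭.asIdeal w.asIdeal,
      Ideal.inertiaDeg_tower (R := ℤ) 𝔭.asIdeal w.asIdeal]
    congr 1
    calc 𝔭.asIdeal.ramificationIdx ℤ * w.asIdeal.ramificationIdx (𝓞 K) *
          (𝔭.asIdeal.inertiaDeg ℤ * w.asIdeal.inertiaDeg (𝓞 K))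
        = (𝔭.asIdeal.ramificationIdx ℤ * 𝔭.asIdeal.inertiaDeg ℤ) *
          (w.asIdeal.ramificationIdx (𝓞 K) * w.asIdeal.inertiaDeg (𝓞 K)) := by ring
      _ = w.asIdeal.ramificationIdx (𝓞 K) * w.asIdeal.inertiaDeg (𝓞 K) := by rw [hef, one_mul]
  rw [Finset.prod_congr rfl hfac, Finset.prod_pow_eq_pow_sum]
  congr 1
  -- the fundamental identity, summed over `primesOverFinset 𝔭`
  rw [← Ideal.sum_ramification_inertia (R := 𝓞 K) (S := 𝓞 L) K L h𝔭0]
  refine Finset.sum_nbij (fun w ↦ w.asIdeal) (fun w hw ↦ ?_) (fun w₁ _ w₂ _ h ↦ HeightOneSpectrum.ext h)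
    (fun Q hQ ↦ ?_) (fun w hw ↦ ?_)
  · -- `w.asIdeal ∈ primesOverFinset 𝔭`
    haveI := hlies w hw
    rw [IsDedekindDomain.mem_primesOverFinset_iff h𝔭0]
    exact ⟨w.isPrime, inferInstance⟩
  · -- every prime of `𝓞 L` over `𝔭` is the ideal of a place over `𝔭`
    have hQ' : Q ∈ 𝔭.asIdeal.primesOver (𝓞 L) := (IsDedekindDomain.mem_primesOverFinset_iff h𝔭0 (𝓞 L)).mp hQ
    haveI : Q.IsPrime := hQ'.1
    haveI : Q.LiesOver 𝔭.asIdeal := hQ'.2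
    have hQ0 : Q ≠ ⊥ := Ideal.ne_bot_of_mem_primesOver h𝔭0 hQ'
    refine ⟨⟨Q, hQ'.1, hQ0⟩, ?_, rfl⟩
    rw [Finset.mem_coe, hP]
    exact HeightOneSpectrum.ext (Ideal.LiesOver.over (p := 𝔭.asIdeal) (P := Q)).symm
  · -- the summands agree: `e(w|𝓞K) f(w|𝓞K) = e′ f′`
    haveI := hlies w hw
    haveI : w.asIdeal.IsMaximal := w.isMaximal
    rw [Ideal.ramificationIdx'_eq_ramificationIdx 𝔭.asIdeal w.asIdeal h𝔭0, Ideal.inertiaDeg'_eq_inertiaDeg 𝔭.asIdeal w.asIdeal]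

/-- **`∏_{w ∣ 𝔭} #(𝓞_w / p^k) = p^{k·[L:K]}`** at a degree-one place `𝔭 ∣ p` (§3 and `#(𝓞_w/(ab)) = #(𝓞_w/(a)) · #(𝓞_w/(b))`, tree `Rank1Residual.GaloisImage.natCard_quotient_span_singleton_mul'`).
[cite: NeukirchANT1999, Ch. I §8 Prop. (8.2) and Ch. II §8 (8.5)] [cite: MilneADT2006, I Lemma 3.3] -/
theorem prod_natCard_adicCompletionIntegers_quotient_pow_eq_pow_finrank (𝔭 : HeightOneSpectrum (𝓞 K))
    (hp𝔭 : ((p : ℕ) : 𝓞 K) ∈ 𝔭.asIdeal) (hef : 𝔭.asIdeal.ramificationIdx ℤ * 𝔭.asIdeal.inertiaDeg ℤ = 1)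
    (P : Finset (HeightOneSpectrum (𝓞 L))) (hP : ∀ w, w ∈ P ↔ w.under (𝓞 K) = 𝔭) (k : ℕ) :
    ∏ w ∈ P, Nat.card (w.adicCompletionIntegers L ⧸ Ideal.span {((p ^ k : ℕ) : w.adicCompletionIntegers L)}) =
      p ^ (k * Module.finrank K L) := by
  have hp : p.Prime := Fact.out
  induction k with
  | zero =>
    rw [zero_mul, pow_zero]
    refine Finset.prod_eq_one fun w _ ↦ ?_
    rw [Nat.cast_one, Ideal.span_singleton_one]
    haveI : Subsingleton (w.adicCompletionIntegers L ⧸ (⊤ : Ideal (w.adicCompletionIntegers L))) :=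
      Ideal.Quotient.subsingleton_iff.mpr rfl
    exact Nat.card_of_subsingleton (0 : w.adicCompletionIntegers L ⧸ (⊤ : Ideal _))
  | succ k ih =>
    have hstep : ∀ w ∈ P,
        Nat.card (w.adicCompletionIntegers L ⧸ Ideal.span {((p ^ (k + 1) : ℕ) : w.adicCompletionIntegers L)}) =
          Nat.card (w.adicCompletionIntegers L ⧸ Ideal.span {((p ^ k : ℕ) : w.adicCompletionIntegers L)}) *
            Nat.card (w.adicCompletionIntegers L ⧸ Ideal.span {(p : w.adicCompletionIntegers L)}) := by
      intro w _
      have ha : ((p ^ k : ℕ) : w.adicCompletionIntegers L) ≠ 0 := LocalPoints.natCast_ne_zero w (pow_ne_zero k hp.ne_zero)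
      rw [show ((p ^ (k + 1) : ℕ) : w.adicCompletionIntegers L) =
          ((p ^ k : ℕ) : w.adicCompletionIntegers L) * (p : w.adicCompletionIntegers L) by push_cast; ring,
        Summit.BirchSwinnertonDyer.Rank1Residual.GaloisImage.natCard_quotient_span_singleton_mul' ha]
    rw [Finset.prod_congr rfl hstep, Finset.prod_mul_distrib, ih,
      prod_natCard_adicCompletionIntegers_quotient_eq_pow_finrank p 𝔭 hp𝔭 hef P hP, ← pow_add, Nat.succ_mul]

end DegreeOne

/-! ## §3b The degree-one hypothesis over `𝓞 ℚ` (the crux's spelling) versus over `ℤ` -/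

section RatInt

variable {F : Type} [Field F] [NumberField F]

/-- **Degree one over `𝓞 ℚ` (the crux's hypotheses `e(𝔭|𝓞 ℚ) = f(𝔭|𝓞 ℚ) = 1`) gives `e(𝔭|ℤ) · f(𝔭|ℤ) = 1`**, the form consumed by
§3–§4: `e(𝔭|𝓞 ℚ) = e(𝔭|ℤ)` (`ℤ → 𝓞 ℚ` is onto, so the two extended ideals in `(𝓞 F)_𝔭` coincide) and `f(𝔭|𝓞 ℚ) = f(𝔭|ℤ)` (tower
`ℤ → 𝓞 ℚ → 𝓞 F`, `ℤ/(p) ≅ 𝓞 ℚ/𝔮`) — the arguments of the tree's `CompletionLocalDegree` private lemmas /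
`NeukirchUchidaProof.ramificationIdx_ringOfIntegersRat_eq_int'`, inlined to keep this file's imports inside the summit. [folklore] -/
theorem ramificationIdx_mul_inertiaDeg_int_eq_one (𝔭 : HeightOneSpectrum (𝓞 F))
    (he : 𝔭.asIdeal.ramificationIdx (𝓞 ℚ) = 1) (hf : 𝔭.asIdeal.inertiaDeg (𝓞 ℚ) = 1) :
    𝔭.asIdeal.ramificationIdx ℤ * 𝔭.asIdeal.inertiaDeg ℤ = 1 := by
  set q : Ideal (𝓞 F) := 𝔭.asIdeal with hq
  haveI hqmax : q.IsMaximal := 𝔭.isMaximal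
  -- `e(q|𝓞 ℚ) = e(q|ℤ)`
  have heq : q.ramificationIdx (𝓞 ℚ) = q.ramificationIdx ℤ := by
    rw [Ideal.ramificationIdx_def, Ideal.ramificationIdx_def]
    have hsurj : Function.Surjective (algebraMap ℤ (𝓞 ℚ)) := Rat.int_algebraMap_surjective _
    have hφ : algebraMap ℤ (Localization.AtPrime q) =
        (algebraMap (𝓞 ℚ) (Localization.AtPrime q)).comp (algebraMap ℤ (𝓞 ℚ)) :=
      RingHom.ext_int _ _
    have hunder : q.under ℤ = (q.under (𝓞 ℚ)).comap (algebraMap ℤ (𝓞 ℚ)) := by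
      rw [Ideal.under_def, Ideal.under_def, Ideal.comap_comap, ← RingHom.ext_int
        (algebraMap ℤ (𝓞 F)) ((algebraMap (𝓞 ℚ) (𝓞 F)).comp (algebraMap ℤ (𝓞 ℚ)))]
    have hI : (q.under ℤ).map (algebraMap ℤ (Localization.AtPrime q)) =
        (q.under (𝓞 ℚ)).map (algebraMap (𝓞 ℚ) (Localization.AtPrime q)) := by
      rw [hunder, hφ, ← Ideal.map_map, Ideal.map_comap_of_surjective _ hsurj]
    rw [hI]
  -- `f(Q|ℤ) = 1` for the maximal ideal `Q = q ∩ 𝓞 ℚ` of `𝓞 ℚ`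
  set Q : Ideal (𝓞 ℚ) := q.under (𝓞 ℚ) with hQ
  haveI hQmax : Q.IsMaximal := Ideal.IsMaximal.under (𝓞 ℚ) q
  have hfQ : Q.inertiaDeg ℤ = 1 := by
    haveI : (Q.under ℤ).IsMaximal := Ideal.IsMaximal.under ℤ Q
    rw [← Ideal.inertiaDeg'_eq_inertiaDeg (Q.under ℤ) Q, Ideal.inertiaDeg'_algebraMap]
    letI : Field (ℤ ⧸ Q.under ℤ) := Ideal.Quotient.field _
    letI : Field (𝓞 ℚ ⧸ Q) := Ideal.Quotient.field _
    have hsurj : Function.Surjective (algebraMap (ℤ ⧸ Q.under ℤ) (𝓞 ℚ ⧸ Q)) := by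
      intro y
      obtain ⟨y, rfl⟩ := Ideal.Quotient.mk_surjective y
      obtain ⟨x, rfl⟩ := Rat.int_algebraMap_surjective (𝓞 ℚ) y
      exact ⟨Ideal.Quotient.mk _ x, rfl⟩
    have e : (ℤ ⧸ Q.under ℤ) ≃ₗ[ℤ ⧸ Q.under ℤ] (𝓞 ℚ ⧸ Q) :=
      LinearEquiv.ofBijective (Algebra.linearMap (ℤ ⧸ Q.under ℤ) (𝓞 ℚ ⧸ Q))
        ⟨(algebraMap (ℤ ⧸ Q.under ℤ) (𝓞 ℚ ⧸ Q)).injective, hsurj⟩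
    rw [← e.finrank_eq, Module.finrank_self]
  -- `f(q|𝓞 ℚ) = f(q|ℤ)` by the tower
  have hfeq : q.inertiaDeg (𝓞 ℚ) = q.inertiaDeg ℤ := by
    rw [Ideal.inertiaDeg_tower (R := ℤ) Q q, hfQ, one_mul]
  rw [← heq, ← hfeq, he, hf]

end RatInt

/-! ## §4 At the layer `K_m` under (H0): `∏_{w ∣ 𝔭} #𝓛_w(E/K_m, p^k) = p^{k·p^m}` -/

section LayerAtP

variable {K : Type} [Field K] [NumberField K] {p : ℕ} [Fact p.Prime] (κ : ZpExtension K p)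
  (W : WeierstrassCurve K) [W.IsElliptic]

/-- **`∏_{w ∣ 𝔭} #𝓛_w(E/K_m, p^k) = p^{k·p^m}` at a degree-one place `𝔭 ∣ p` under (H0)** «no non-zero point of `E[p^k]` is fixed by
`D_𝔭 ∩ Gal(K̄/K_∞)`»: each local Kummer condition has `#E(K_{m,w})[p^k] · #(𝓞_w/p^k)` elements (Milne I 3.3, tree
`natCard_kummerSelmerStructure_inr`), the first factor is `#E[p^k]^{D_𝔭 ⊓ Γ_m} = 1` (local torsion dictionary
`…LayerLocalTorsionDictionary.natCard_ker_nsmul_adicCompletion_layer_eq`; `D_𝔭 ⊓ Γ_m ⊇ D_𝔭 ⊓ ker κ`), and `∏_{w ∣ 𝔭} #(𝓞_w/p^k) = p^{k·[K_m:K]}`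
(§3) with `[K_m : K] = p^m` (`ZpExtension.finrank_layer_holds`). [cite: MilneADT2006, I §3 Lemma 3.3]
[cite: NeukirchANT1999, Ch. I §8 Prop. (8.2)] [cite: Washington1997, §13.1] [cite: GreenbergVatsal2000, §2 Prop. (2.1) (local terms at `p`)] -/
theorem prod_natCard_kummerSelmerStructure_inr_layer_eq_pow (𝔭 : HeightOneSpectrum (𝓞 K))
    (hp𝔭 : ((p : ℕ) : 𝓞 K) ∈ 𝔭.asIdeal) (hef : 𝔭.asIdeal.ramificationIdx ℤ * 𝔭.asIdeal.inertiaDeg ℤ = 1) (m k : ℕ)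
    (h0 : ∀ P : W.geomTorsion ((p ^ k : ℕ) : ℤ), (∀ g ∈ decomp (K := K) 𝔭 ⊓ κ.kerSubgroup, g • P = P) → P = 0)
    (P : Finset (HeightOneSpectrum (𝓞 (κ.layer m)))) (hP : ∀ w, w ∈ P ↔ w.under (𝓞 K) = 𝔭) :
    ∏ w ∈ P, Nat.card ((W.baseChange (κ.layer m)).kummerSelmerStructure ((p ^ k : ℕ) : ℤ) (Sum.inr w)) =
      p ^ (k * p ^ m) := by
  have hp : p.Prime := Fact.out
  have hn : p ^ k ≠ 0 := pow_ne_zero k hp.ne_zero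
  -- the torsion factor is `1` at every `w ∣ 𝔭`
  have htors : ∀ w ∈ P, Nat.card (nsmulAddMonoidHom (p ^ k) :
      ((W.baseChange (κ.layer m)).baseChange (w.adicCompletion (κ.layer m))).toAffine.Point →+ _).ker = 1 := by
    intro w hw
    haveI : w.asIdeal.LiesOver 𝔭.asIdeal := ⟨(congrArg HeightOneSpectrum.asIdeal ((hP w).mp hw)).symm⟩
    rw [natCard_ker_nsmul_adicCompletion_layer_eq W p κ 𝔭 m hn w, Nat.card_eq_one_iff_exists]
    refine ⟨⟨0, fun g _ ↦ smul_zero g⟩, fun Q ↦ Subtype.ext (h0 Q.1 fun g hg ↦ Q.2 g ?_)⟩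
    exact Subgroup.mem_inf.mpr ⟨(Subgroup.mem_inf.mp hg).1, κ.kerSubgroup_le_layerSubgroup m (Subgroup.mem_inf.mp hg).2⟩
  have hfac : ∀ w ∈ P, Nat.card ((W.baseChange (κ.layer m)).kummerSelmerStructure ((p ^ k : ℕ) : ℤ) (Sum.inr w)) =
      Nat.card (w.adicCompletionIntegers (κ.layer m) ⧸
        Ideal.span {((p ^ k : ℕ) : w.adicCompletionIntegers (κ.layer m))}) := by
    intro w hw
    rw [(W.baseChange (κ.layer m)).natCard_kummerSelmerStructure_inr w hn, htors w hw, one_mul]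
  haveI : PerfectField K := PerfectField.ofCharZero
  rw [Finset.prod_congr rfl hfac, prod_natCard_adicCompletionIntegers_quotient_pow_eq_pow_finrank p 𝔭 hp𝔭 hef P hP k,
    κ.finrank_layer_holds m]

omit [NumberField K] [Fact p.Prime] [W.IsElliptic] in
/-- (H0) for `E[p]` implies the vanishing of every `G`-fixed point killed by a power of `p`: a non-zero fixed point `Q` with
`p^{k+1} Q = 0` has the fixed multiple `p^k Q ∈ E[p]`, hence `p^k Q = 0`, and induction. [folklore] -/
theorem eq_zero_of_pow_smul_eq_zero_of_fixed (G : Subgroup (absoluteGaloisGroup K))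
    (h0 : ∀ P : W.geomTorsion (p : ℤ), (∀ g ∈ G, g • P = P) → P = 0) :
    ∀ (k : ℕ) (Q : geomPoints W), p ^ k • Q = 0 → (∀ g ∈ G, g • Q = Q) → Q = 0 := by
  intro k
  induction k with
  | zero =>
    intro Q hQ _
    rwa [pow_zero, one_smul] at hQ
  | succ k ih =>
    intro Q hQ hfix
    have hmem : p ^ k • Q ∈ W.geomTorsion (p : ℤ) := by
      rw [AddSubgroup.torsionBy.nsmul_iff, smul_smul, ← pow_succ']
      exact hQ
    have hfix' : ∀ g ∈ G, g • (⟨p ^ k • Q, hmem⟩ : W.geomTorsion (p : ℤ)) = ⟨p ^ k • Q, hmem⟩ := by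
      intro g hg
      apply Subtype.ext
      change g • (p ^ k • Q) = p ^ k • Q
      rw [smul_comm, hfix g hg]
    have hzero : p ^ k • Q = 0 := congrArg Subtype.val (h0 _ hfix')
    exact ih Q hzero hfix

omit [NumberField K] [Fact p.Prime] [W.IsElliptic] in
/-- (H0) for `E[p]` implies (H0) for every `E[p^k]`. [folklore] -/
theorem forall_geomTorsion_pow_eq_zero_of_prime (G : Subgroup (absoluteGaloisGroup K))
    (h0 : ∀ P : W.geomTorsion (p : ℤ), (∀ g ∈ G, g • P = P) → P = 0) (k : ℕ) :
    ∀ P : W.geomTorsion ((p ^ k : ℕ) : ℤ), (∀ g ∈ G, g • P = P) → P = 0 := by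
  intro P hP
  have hQ : p ^ k • (P : geomPoints W) = 0 := AddSubgroup.torsionBy.nsmul_iff.mp P.2
  have hfix : ∀ g ∈ G, g • (P : geomPoints W) = (P : geomPoints W) := fun g hg ↦
    congrArg Subtype.val (hP g hg)
  exact Subtype.ext (eq_zero_of_pow_smul_eq_zero_of_fixed W G h0 k (P : geomPoints W) hQ hfix)

/-- **The same with (H0) stated for `E[p]`** (the shape of the lead's `…ResidualLinkOfLayerCount` hypothesis `h0`):
`∏_{w ∣ 𝔭} #𝓛_w(E/K_m, p^k) = p^{k·p^m}` for every `m`, `k`. [cite: MilneADT2006, I §3 Lemma 3.3] [cite: NeukirchANT1999, Ch. I §8 Prop. (8.2)] -/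
theorem prod_natCard_kummerSelmerStructure_inr_layer_eq_pow_of_prime (𝔭 : HeightOneSpectrum (𝓞 K))
    (hp𝔭 : ((p : ℕ) : 𝓞 K) ∈ 𝔭.asIdeal) (hef : 𝔭.asIdeal.ramificationIdx ℤ * 𝔭.asIdeal.inertiaDeg ℤ = 1)
    (h0 : ∀ P : W.geomTorsion (p : ℤ), (∀ g ∈ decomp (K := K) 𝔭 ⊓ κ.kerSubgroup, g • P = P) → P = 0) (m k : ℕ)
    (P : Finset (HeightOneSpectrum (𝓞 (κ.layer m)))) (hP : ∀ w, w ∈ P ↔ w.under (𝓞 K) = 𝔭) :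
    ∏ w ∈ P, Nat.card ((W.baseChange (κ.layer m)).kummerSelmerStructure ((p ^ k : ℕ) : ℤ) (Sum.inr w)) =
      p ^ (k * p ^ m) :=
  prod_natCard_kummerSelmerStructure_inr_layer_eq_pow κ W 𝔭 hp𝔭 hef m k
    (forall_geomTorsion_pow_eq_zero_of_prime W (decomp (K := K) 𝔭 ⊓ κ.kerSubgroup) h0 k) P hP

end LayerAtP



end Summit.BirchSwinnertonDyer.BirchSwinnertonDyer.Theorems.UniversalToricDescentLayerLocalFactorsAtP

end
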